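import Summits.BirchSwinnertonDyer.BirchSwinnertonDyer.Theorems.GenusKolyvaginAtTwoEquivariantKolyvaginExactAtTwoEigenClassesFinite
import Summits.BirchSwinnertonDyer.BirchSwinnertonDyer.Theorems.GenusKolyvaginAtTwoGenusPrimitiveSupplyAtTwoKolyvaginClassAtTwo
import Summits.BirchSwinnertonDyer.BirchSwinnertonDyer.Theorems.GenusKolyvaginAtTwoVisiblePairAtTwoDefs
import Summits.BirchSwinnertonDyer.Rank1Residual.X11b.KolyvaginBottomPoint
import Summits.BirchSwinnertonDyer.BirchSwinnertonDyer.Theorems.SelmerRankSelmerRankLBStubHeegnerBottomTorsion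
import Literature.NumberTheory.EllipticCurves.HeegnerPointsGaloisDescent
import Literature.NumberTheory.EllipticCurves.HeegnerPointsKolyvaginPrimaryLeavesProofs
import HarnessLib

/-!
# Route `GenusKolyvaginAtTwo`, LINE 6, KEY crux Q3 (inner statement of stmt-BirchSwinnertonDyer-22137):
# Kolyvagin's `M₀` in KUMMER CURRENCY — from `2^{M₀} ∥ P(1)` in `E(K[1])` to a class `x ∈ H¹(ℚ, E[2^M])` of order
# `≥ 2^M/2` with `res x` Selmer over `K` and `2^{M₀}·res x = c_M(1)` (the inputs `x`, `hxK`, `x_ord`, `hc1` of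
# `…VisiblePairAtTwoClaimsOfHeegner`)

Helper (seat `bsd-line-gk2-p3` g13; `--supports` the crux, closes nothing). The crux `KolyvaginExactAtTwo` defines `M₀` by the
`2`-divisibility of the derived point `P(1) ∈ E(K[1])` of a conductor-`1` Kolyvagin–Heegner datum `d₁` (`2^{M₀} Q = P(1)` solvable,
`2^{M₀+1} Q = P(1)` not). The pair descent wants the class `x`: `c_M(1) = 2^{M₀}·res x`. This file performs the bookkeeping
(Gross 1991 §1, §4 (4.4); McCallum 1991 §4 (6), §5 p. 303) on the LINE-6 habitat (`ρ̄_{E,2}` onto, `K = ℚ(θ)` imaginary quadratic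
with `θ² = d_K` odd, Heegner hypothesis, `w(E) = −1`):

* §1 `exists_map_eq_of_forall_pointGalHom_eq`, `exists_map_eq_of_pow_smul_eq_derivedPoint` — a `Gal(K[1]/K)`-fixed point, in
  particular a `2^{k}`-th root of `P(1) = Tr_{K[1]/K} y(1)`, of `E(K[1])` descends to `E(K)` (Galois descent; `E(K[1])[2^∞] = 0`,
  `GenusKoly.heegner_two_pow_torsion_free`; `P(1)` itself: the tree's `bottomTorsion_exists_map_eq_derivedPoint`).
* §2 `kolyvaginClass_one_two_eq_kummerMapTorsion` — **`c_M(1) = δ_{2^M}(P₀)`** (admissibility at `2`: `GenusKoly.isAdmissible_pointsSubgroup_two`;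
  `[P(1)]` is `Γ_K`-fixed; `kolyvaginClass_toGeomPoints`).
* §3 `exists_kummer_class_of_pow_smul_eq_derivedPoint` — **the class `x`**: given `2^{M₀} Q₁ = P(1)` in `E(K[1])`,
  `2^{M₀+1} ∤ P(1)` there, and Gross's Prop. 5.3 for the descended point (`τ P₀ − (−w(E)) P₀` torsion — displayed hypothesis
  `h53`, in print; the tree has it for `IsHeegnerPoint` via `X11b.KolyvaginBottomPoint.isOfFinAddOrder_map_sub_neg_rootNumber_smul`
  modulo Shimura reciprocity at conductor `1`), there is `x ∈ H¹(ℚ, E[2^M])` with `res x = δ_{2^M}(Q) ∈ Sel^{(2^M)}(E/K)`,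
  `2^{M−1} x ≠ 0` and `2^{M₀}·res x = c_M(1)`.

THEOREMS ONLY (no definition, no named fact, no `sorry`, standard axioms). BSD is not proved by any of this.

References: [GrossLMS1991] §1 (`y_K = Tr y_1`), §4 (4.4), Lemma 4.3, §5 (5.1), Prop. 5.3; [McCallumLMS1991] §4 (6), §5 (p. 303);
[Kolyvagin1989Izv] §3.
-/

set_option autoImplicit false
set_option linter.dupNamespace false -- tree convention: `Summit.BirchSwinnertonDyer.BirchSwinnertonDyer.Theorems` (summit = sub-problem)

noncomputable section

open scoped Classical

namespace Summit.BirchSwinnertonDyer.BirchSwinnertonDyer.Theorems.GenusExact.VisiblePairAtTwo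

open WeierstrassCurve NumberField IsDedekindDomain Field
open Literature.NumberTheory.EllipticCurves Literature.NumberTheory.GaloisRepresentations
open Literature.NumberTheory.EllipticCurves.ModularForms Literature.NumberTheory.EllipticCurves.KolyvaginCocycle
open Summit.BirchSwinnertonDyer.BirchSwinnertonDyer.Theorems.GenusExact.EigenClassesFinite
open Summit.BirchSwinnertonDyer.Rank1Residual.X11b

variable (W : WeierstrassCurve ℚ) [NeZero (W.conductorNorm ℤ)]
  (K : Type) [Field K] [NumberField K] {Dt : ModularParametrizationData W (W.conductorNorm ℤ)} {β : ℤ} {ι : K →+* ℂ}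

/-! ## §1 Descent from `E(K[1])` to `E(K)` -/

omit [NeZero (W.conductorNorm ℤ)] in
/-- **A `Gal(K[1]/K)`-fixed point of `E(K[1])` descends to `E(K)`** (`K[1]/K` Galois; Galois descent of points).
[cite: GrossLMS1991, §1 (p. 236)] -/
theorem exists_map_eq_of_forall_pointGalHom_eq (hK : IsImaginaryQuadratic K)
    (P : (W.baseChange (ringClassField K ι 1)).toAffine.Point)
    (hP : ∀ g ∈ ringClassGal ι 1, pointGalHom W (ringClassField K ι 1) g P = P) :
    ∃ P₀ : (W.baseChange K).toAffine.Point,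
      WeierstrassCurve.Affine.Point.map (W' := W) (algebraMap K (ringClassField K ι 1)).toRatAlgHom P₀ = P := by
  haveI := (finiteDimensional_and_isGalois_ringClassField hK ι one_ne_zero).2
  refine exists_map_eq_of_forall_map_galois_eq W fun σ ↦ ?_
  have hσ : σ.restrictScalars ℚ ∈ ringClassGal ι 1 := by
    rw [ringClassGal, mem_fixingSubgroup_iff]
    rintro x ⟨k, hk⟩
    have hx : x = algebraMap K (ringClassField K ι 1) k := Subtype.ext hk.symm
    rw [hx, AlgEquiv.smul_def, AlgEquiv.restrictScalars_apply]
    exact σ.commutes k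
  exact (pointMap_restrictScalars_eq_pointGalHom σ P).trans (hP _ hσ)

/-- **A `2^k`-th root of `P(1)` in `E(K[1])` descends to `E(K)`** on the habitat (`ρ̄_{E,2}` onto, `d_K` odd, Heegner): for
`g ∈ Gal(K[1]/K)`, `2^k (gQ − Q) = gP(1) − P(1) = 0` and `E(K[1])` has no `2`-power torsion. [cite: GrossLMS1991, §4 Lemma 4.3] -/
theorem exists_map_eq_of_pow_smul_eq_derivedPoint [W.IsElliptic] [W.IsGloballyMinimal] (hK : IsImaginaryQuadratic K) (hodd : Odd (NumberField.discr K))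
    (hH : SatisfiesHeegnerHypothesis (W.conductorNorm ℤ) K) (hsurj : W.HasSurjectiveModNGaloisRep ((2 : ℤ) ^ 1))
    (d : KolyvaginHeegnerData Dt β ι 1) {k : ℕ} {Q : (W.baseChange (ringClassField K ι 1)).toAffine.Point}
    (hQ : ((2 ^ k : ℕ) : ℤ) • Q = d.derivedPoint) :
    ∃ Q₀ : (W.baseChange K).toAffine.Point,
      WeierstrassCurve.Affine.Point.map (W' := W) (algebraMap K (ringClassField K ι 1)).toRatAlgHom Q₀ = Q := by
  refine exists_map_eq_of_forall_pointGalHom_eq W K hK Q fun g hg ↦ ?_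
  have h0 : ((2 ^ k : ℕ) : ℤ) • (pointGalHom W (ringClassField K ι 1) g Q - Q) = 0 := by
    rw [zsmul_sub, ← map_zsmul, hQ, bottomTorsion_pointGalHom_derivedPoint d hg, sub_self]
  exact sub_eq_zero.mp (GenusKoly.heegner_two_pow_torsion_free (ι := ι) hK hodd hH hsurj one_ne_zero k _ h0)

/-! ## §2 `c_M(1) = δ_{2^M}(P₀)` -/

/-- **`c_M(1) = δ_{2^M}(P₀)` at `p = 2`** for the descended point `P₀ ∈ E(K)` of `P(1)`, on the habitat: `E(K[1]) ⊆ E(K̄)` is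
admissible for `2^M` (`GenusKoly.isAdmissible_pointsSubgroup_two`) and `[P(1)]` is `Γ_K`-fixed, so Kolyvagin's class is the
Kummer class (`kolyvaginClass_toGeomPoints`). [cite: GrossLMS1991, §4 (4.4)] [cite: McCallumLMS1991, §4 (6)] -/
theorem kolyvaginClass_one_two_eq_kummerMapTorsion [W.IsElliptic] [W.IsGloballyMinimal] (hK : IsImaginaryQuadratic K) (hodd : Odd (NumberField.discr K))
    (hH : SatisfiesHeegnerHypothesis (W.conductorNorm ℤ) K) (hsurj : W.HasSurjectiveModNGaloisRep ((2 : ℤ) ^ 1)) (M : ℕ)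
    (d : KolyvaginHeegnerData Dt β ι 1) (P₀ : (W.baseChange K).toAffine.Point)
    (hP₀ : WeierstrassCurve.Affine.Point.map (W' := W) (algebraMap K (ringClassField K ι 1)).toRatAlgHom P₀ =
      d.derivedPoint) :
    d.kolyvaginClass Nat.prime_two M =
      kummerMapTorsion (W.baseChange K) ((2 ^ M : ℕ) : ℤ)
        ((W.baseChange K).zsmul_geomPoints_surjective_of_charZero (by exact_mod_cast pow_ne_zero M two_ne_zero)) P₀ := by
  have hA := GenusKoly.isAdmissible_pointsSubgroup_two hK hodd hH hsurj one_ne_zero d M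
  have hgeom : d.toGeomPoints d.derivedPoint = toGeomPoints (W.baseChange K) P₀ := by
    rw [← hP₀]; exact KolyvaginBottom.toGeomPoints_map_algebraMap d P₀
  have hP : d.toGeomPoints d.derivedPoint ∈ invPoints (absoluteGaloisGroup K) d.pointsSubgroup ((2 ^ M : ℕ) : ℤ) := by
    refine mem_invPoints_of_fixed ⟨d.derivedPoint, rfl⟩ fun g ↦ ?_
    rw [hgeom]
    exact toGeomPoints_mem_fixedPoints (W.baseChange K) P₀ g
  rw [d.kolyvaginClass_of_admissible Nat.prime_two M hA hP]
  have key : ∀ (P : geomPoints (W.baseChange K))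
      (hP' : P ∈ invPoints (absoluteGaloisGroup K) d.pointsSubgroup ((2 ^ M : ℕ) : ℤ)),
      P = toGeomPoints (W.baseChange K) P₀ →
      Literature.NumberTheory.EllipticCurves.kolyvaginClass (W.baseChange K) ((2 ^ M : ℕ) : ℤ)
        ((W.baseChange K).zsmul_geomPoints_surjective_of_charZero (by exact_mod_cast pow_ne_zero M two_ne_zero))
        hA P hP' =
      kummerMapTorsion (W.baseChange K) ((2 ^ M : ℕ) : ℤ)
        ((W.baseChange K).zsmul_geomPoints_surjective_of_charZero (by exact_mod_cast pow_ne_zero M two_ne_zero)) P₀ := by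
    rintro P hP' rfl
    exact kolyvaginClass_toGeomPoints hA P₀ hP'
  exact key _ hP hgeom

/-! ## §3 The class `x` -/

/-- **Kolyvagin's `M₀` in Kummer currency.** On the habitat (`E` globally minimal, `ρ̄_{E,2}` onto, `K = ℚ(θ)` imaginary quadratic,
`θ² = d_K` odd, Heegner hypothesis, `w(E) = −1`, `M ≥ 1`), for a conductor-`1` datum `d₁` with `2^{M₀} Q₁ = P(1)` solvable in
`E(K[1])` and `2^{M₀+1} Q = P(1)` not, and Gross's Prop. 5.3 for the descended point (`h53`: `τP₀ + w(E)P₀` torsion for every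
`P₀ ∈ E(K)` above `P(1)`): there is `x ∈ H¹(ℚ, E[2^M])` with `res x ∈ Sel^{(2^M)}(E/K)`, `2^{M−1} x ≠ 0` and
`2^{M₀}·res x = c_M(1)` — the inputs `x`, `hxK`, `x_ord`, `hc1` of `pow_zsmul_selmer_eq_zero_and_selmer_le_of_heegnerData`.
(`x` is the descent of `δ_{2^M}(Q)`, `Q ∈ E(K)` the descended root; `δ(Q)` is `τ`-invariant because `τQ − Q` is a root of odd
torsion, hence `2^M`-divisible in the `2`-torsion-free group `E(K)`.) [cite: McCallumLMS1991, §5 (p. 303)] [cite: GrossLMS1991,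
§4 (4.4), §5 (5.1), Prop. 5.3] -/
theorem exists_kummer_class_of_pow_smul_eq_derivedPoint [W.IsElliptic] [W.IsGloballyMinimal] (hK : IsImaginaryQuadratic K) (hodd : Odd (NumberField.discr K))
    (hH : SatisfiesHeegnerHypothesis (W.conductorNorm ℤ) K) (hs : W.HasSurjectiveModNGaloisRep 2)
    {θ : K} (hθ : θ ∉ Set.range (algebraMap ℚ K)) (hθsq : θ ^ 2 = algebraMap ℚ K ((NumberField.discr K : ℤ) : ℚ))
    (hw : W.rootNumber = -1) {M : ℕ} (hM : 1 ≤ M) (d₁ : KolyvaginHeegnerData Dt β ι 1) {M₀ : ℕ}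
    (hdiv : ∃ Q : (W.baseChange (ringClassField K ι 1)).toAffine.Point, ((2 ^ M₀ : ℕ) : ℤ) • Q = d₁.derivedPoint)
    (hndiv : ¬ ∃ Q : (W.baseChange (ringClassField K ι 1)).toAffine.Point, ((2 ^ (M₀ + 1) : ℕ) : ℤ) • Q = d₁.derivedPoint)
    (h53 : ∀ P₀ : (W.baseChange K).toAffine.Point,
      WeierstrassCurve.Affine.Point.map (W' := W) (algebraMap K (ringClassField K ι 1)).toRatAlgHom P₀ = d₁.derivedPoint →
      IsOfFinAddOrder (WeierstrassCurve.Affine.Point.map (W' := W) (sigmaQ K hK.1 hθ hθsq : K →ₐ[ℚ] K) P₀ -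
        (-W.rootNumber) • P₀)) :
    ∃ x : galH1Torsion W (lvl M), resTorsion W K (lvl M) x ∈ selmerGroup (W.baseChange K) (lvl M) ∧
      ((2 : ℤ) ^ (M - 1)) • x ≠ 0 ∧
      ((2 : ℤ) ^ M₀) • resTorsion W K (lvl M) x = d₁.kolyvaginClass Nat.prime_two M := by
  have hsurj : W.HasSurjectiveModNGaloisRep ((2 : ℤ) ^ 1) := by rwa [pow_one]
  set hdv := (W.baseChange K).zsmul_geomPoints_surjective_of_charZero (n := ((2 ^ M : ℕ) : ℤ))
    (by exact_mod_cast pow_ne_zero M two_ne_zero) with hhdv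
  set δ := kummerMapTorsion (W.baseChange K) ((2 ^ M : ℕ) : ℤ) hdv with hδ
  -- no `2`-power torsion in `E(K)`
  have hL : ∀ k : ℕ, ∀ P : (W.baseChange K).toAffine.Point, (((2 ^ k : ℕ) : ℤ)) • P = 0 → P = 0 := fun k ↦
    forall_zsmul_two_pow_baseChange_eq_zero_of_hasSurjectiveModNGaloisRep_two W K hK.1 hs k
  have hL' : ∀ k : ℕ, ∀ P : (W.baseChange K).toAffine.Point, ((2 : ℤ) ^ k) • P = 0 → P = 0 := fun k P h ↦
    hL k P (by rwa [Nat.cast_pow, Nat.cast_ofNat])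
  -- the root `Q₁` and its descent `Q`, and `P₀ = 2^{M₀} Q` above `P(1)`
  obtain ⟨Q₁, hQ₁⟩ := hdiv
  obtain ⟨Q, hQ⟩ := exists_map_eq_of_pow_smul_eq_derivedPoint W K hK hodd hH hsurj d₁ hQ₁
  set P₀ : (W.baseChange K).toAffine.Point := ((2 ^ M₀ : ℕ) : ℤ) • Q with hP₀def
  have hP₀ : WeierstrassCurve.Affine.Point.map (W' := W) (algebraMap K (ringClassField K ι 1)).toRatAlgHom P₀ =
      d₁.derivedPoint := by
    rw [hP₀def, map_zsmul, hQ, hQ₁]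
  -- `c_M(1) = δ P₀ = 2^{M₀} δ Q`
  have hc : d₁.kolyvaginClass Nat.prime_two M = ((2 : ℤ) ^ M₀) • δ Q := by
    rw [kolyvaginClass_one_two_eq_kummerMapTorsion W K hK hodd hH hsurj M d₁ P₀ hP₀, hP₀def, map_zsmul,
      show ((2 ^ M₀ : ℕ) : ℤ) = (2 : ℤ) ^ M₀ by rw [Nat.cast_pow, Nat.cast_ofNat]]
  -- `δ Q` is `τ`-invariant: `τ Q - Q` is a `2^{M₀}`-th root of torsion, hence torsion, hence `2^M`-divisible
  have hτQ : conjAct W (sigmaQ K hK.1 hθ hθsq) (lvl M) (δ Q) = δ Q := by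
    have hfin : IsOfFinAddOrder
        (WeierstrassCurve.Affine.Point.map (W' := W) (sigmaQ K hK.1 hθ hθsq : K →ₐ[ℚ] K) Q - Q) := by
      have h1 := h53 P₀ hP₀
      rw [hw, neg_neg, one_smul, hP₀def, map_zsmul, ← zsmul_sub] at h1
      obtain ⟨m, hm, hm0⟩ := h1.exists_nsmul_eq_zero
      refine isOfFinAddOrder_iff_nsmul_eq_zero.mpr ⟨m * 2 ^ M₀, by positivity, ?_⟩
      rw [mul_smul, ← natCast_zsmul _ (2 ^ M₀)]
      exact hm0
    obtain ⟨s, hs'⟩ := exists_pow_smul_eq_of_isOfFinAddOrder Nat.prime_two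
      (fun a ha ↦ hL 1 a (by rw [pow_one, natCast_zsmul]; exact ha)) hfin M
    rw [Nat.cast_ofNat] at hs'
    have hkill : δ (((2 : ℤ) ^ M) • s) = 0 := by
      rw [map_zsmul, show ((2 : ℤ) ^ M) = ((2 ^ M : ℕ) : ℤ) by rw [Nat.cast_pow, Nat.cast_ofNat]]
      exact zsmul_discreteH1_torsion _ (δ s)
    have heq : WeierstrassCurve.Affine.Point.map (W' := W) (sigmaQ K hK.1 hθ hθsq : K →ₐ[ℚ] K) Q =
        Q + ((2 : ℤ) ^ M) • s := by rw [hs', add_sub_cancel]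
    rw [hδ, conjAct_kummerMapTorsion, heq, map_add, ← hδ, hkill, add_zero]
  -- descend `δ Q` to `x ∈ H¹(ℚ, E[2^M])`
  obtain ⟨x, hx, -⟩ := existsUnique_resTorsion_eq_of_conjAct_eq W K hK.1 hθ hθsq (lvl M) (hL M) hτQ
  refine ⟨x, ?_, ?_, ?_⟩
  · -- Kummer classes are Selmer
    rw [hx, mem_selmerGroup_iff]
    exact ⟨fun v ↦ kummerMapTorsion_mem_selmerLocalKer _ _ _ (v.adicCompletion K) Q,
      fun w ↦ kummerMapTorsion_mem_selmerLocalKer _ _ _ w.Completion Q⟩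
  · -- `2^{M-1} x ≠ 0`: otherwise `2^{M-1} Q ∈ 2^M E(K)`, `Q ∈ 2E(K)`, `2^{M₀+1} ∣ P(1)`
    intro h0
    have h1 : δ (((2 : ℤ) ^ (M - 1)) • Q) = 0 := by
      rw [map_zsmul, ← hx, ← map_zsmul, h0, map_zero]
    have h2' : ((2 : ℤ) ^ (M - 1)) • Q ∈ (kummerMapTorsion (W.baseChange K) ((2 ^ M : ℕ) : ℤ) hdv).ker := h1
    rw [kummerMapTorsion_ker] at h2'
    obtain ⟨R, hR⟩ := h2'
    have hR' : ((2 : ℤ) ^ M) • R = ((2 : ℤ) ^ (M - 1)) • Q := by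
      rw [show ((2 : ℤ) ^ M) = ((2 ^ M : ℕ) : ℤ) by rw [Nat.cast_pow, Nat.cast_ofNat]]
      exact hR
    -- `2^{M-1} (2R - Q) = 0`, so `Q = 2R`
    have hQR : Q = (2 : ℤ) • R := by
      have h3 : ((2 : ℤ) ^ (M - 1)) • ((2 : ℤ) • R - Q) = 0 := by
        rw [zsmul_sub, smul_smul, ← pow_succ, Nat.sub_add_cancel hM, hR', sub_self]
      have h4 := hL' (M - 1) _ h3
      rw [sub_eq_zero] at h4
      exact h4.symm
    apply hndiv
    refine ⟨WeierstrassCurve.Affine.Point.map (W' := W) (algebraMap K (ringClassField K ι 1)).toRatAlgHom R, ?_⟩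
    rw [← hP₀, hP₀def, hQR, smul_smul, map_zsmul, Nat.cast_pow, Nat.cast_pow, Nat.cast_ofNat, pow_succ]
  · rw [hx, ← hc]

end Summit.BirchSwinnertonDyer.BirchSwinnertonDyer.Theorems.GenusExact.VisiblePairAtTwo

end
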